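import Mathlib

/-!
# Self-converse lift of a gadget of direct pairs (support file, siege attempt k12)

Item `stmt-MatrixMultiplication-14308` (`FourierTwoFamiliesModP.PrimeTwoFamilies`, CKSU 2005 Conj. 4.7 with
prime cyclic hosts), line `Sketch` (capacity-gadget form), registered stub `selfConverseLift`.

A GADGET is a list of pairs `(P σ, Q σ)_{σ<r}` of finite subsets of an abelian group `K`, each DIRECT
(`(x - x') + (y - y') = 0 → x = x' ∧ y = y'` inside one pair).  Letter `σ` is STRONGLY SEPARATED towards
`τ` if every cross difference `q - p` (`p ∈ P σ`, `q ∈ Q τ`) differs from every diagonal difference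
`q' - p'` (`p' ∈ P c`, `q' ∈ Q c`, any letter `c`).  If a map `π` on the letters strongly separates every
ordered pair of distinct letters either directly or after `π`, the `r` product blocks
`(P σ ×ˢ P (π σ), Q σ ×ˢ Q (π σ))` in `K × K` satisfy the two clauses (W), (X) of the simultaneous double
product property verbatim (`selfConverseLift`; the `L = 2` zero-error code of graph words `(σ, π σ)`,
Lovász's `Θ = √r` code for self-converse confusability patterns, in gadget form).

## Organisation of the proof (variation: certificate on the finite core)

The whole argument factors through ONE finite core statement about a single coordinate (`core`): if letter
`i` is strongly separated towards letter `k`, then no relation `(a - a') + (b - b') = 0` with `a ∈ P i`,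
`a' ∈ P j`, `b ∈ Q j`, `b' ∈ Q k` exists (for any middle letter `j`), because such a relation is exactly a
coincidence `b' - a = b - a'` of a cross difference with a diagonal difference.  Clause (X) for the product
blocks is then read off the one-bit certificate `hπ i k` (which coordinate separates), and clause (W) is
coordinatewise directness.  As a worked, kernel-checked certificate we include Shannon's pentagon gadget in
`ℤ/5` (letters `({u}, {u, u+1})`, `π u = 2u`): its directness and self-converse separation are verified by
`decide`, and `selfConverseLift` turns it into five SDPP blocks in `ℤ/5 × ℤ/5` (`pentagon_lift`), although
at most two of the five letters are pairwise separated directly.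
-/

-- single-conjunct summit: the mandated namespace repeats `MatrixMultiplication` (summit = sub-problem).
set_option linter.dupNamespace false

namespace Summit.MatrixMultiplication.MatrixMultiplication.Theorems.PrimeTwoFamilies.SelfConverseLiftK12

open Finset

/-- **Finite core (one coordinate).**  If letter `i` is strongly separated towards letter `k` (`hs`: every
cross difference `q - p`, `p ∈ P i`, `q ∈ Q k`, differs from every diagonal difference `q' - p'`,
`p' ∈ P c`, `q' ∈ Q c`), then there is no relation `(a - a') + (b - b') = 0` with `a ∈ P i`, `a' ∈ P j`,
`b ∈ Q j`, `b' ∈ Q k`: it would be the coincidence `b' - a = b - a'`. -/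
theorem core {K : Type*} [AddCommGroup K] {r : ℕ} {P Q : Fin r → Finset K} {i j k : Fin r}
    (hs : ∀ p ∈ P i, ∀ q ∈ Q k, ∀ c : Fin r, ∀ p' ∈ P c, ∀ q' ∈ Q c, q - p ≠ q' - p')
    {a a' b b' : K} (ha : a ∈ P i) (ha' : a' ∈ P j) (hb : b ∈ Q j) (hb' : b' ∈ Q k)
    (h : (a - a') + (b - b') = 0) : False := by
  refine hs a ha b' hb' j a' ha' b hb ?_
  have h2 : (a - a') + (b - b') = (b - a') - (b' - a) := by abel
  rw [h2] at h
  exact (sub_eq_zero.1 h).symm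

/-- Componentwise reading of a relation in `K × K`: first coordinates. -/
theorem rel_fst {K : Type*} [AddCommGroup K] {a a' b b' : K × K} (h : (a - a') + (b - b') = 0) :
    (a.1 - a'.1) + (b.1 - b'.1) = 0 := by
  have := congrArg Prod.fst h
  simpa using this

/-- Componentwise reading of a relation in `K × K`: second coordinates. -/
theorem rel_snd {K : Type*} [AddCommGroup K] {a a' b b' : K × K} (h : (a - a') + (b - b') = 0) :
    (a.2 - a'.2) + (b.2 - b'.2) = 0 := by
  have := congrArg Prod.snd h
  simpa using this

/-- **SELF-CONVERSE LIFT** (registered stub `selfConverseLift`, verbatim).  If every letter `(P c, Q c)` is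
direct (`hD`) and a map `π` on the letters strongly separates every ordered pair of distinct letters either
directly or after `π` (`hπ`), then the `r` blocks `(P σ ×ˢ P (π σ), Q σ ×ˢ Q (π σ))` in `K × K` satisfy
clause (W) (first conjunct: coordinatewise directness) and clause (X) (second conjunct: for `i ≠ k` the
certificate `hπ i k` names a coordinate where `core` applies). -/
theorem selfConverseLift {K : Type*} [AddCommGroup K] [DecidableEq K] {r : ℕ}
    (P Q : Fin r → Finset K)
    (hD : ∀ c : Fin r, ∀ x ∈ P c, ∀ x' ∈ P c, ∀ y ∈ Q c, ∀ y' ∈ Q c,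
      (x - x') + (y - y') = 0 → x = x' ∧ y = y')
    (π : Fin r → Fin r)
    (hπ : ∀ σ τ : Fin r, σ ≠ τ →
      (∀ p ∈ P σ, ∀ q ∈ Q τ, ∀ c : Fin r, ∀ p' ∈ P c, ∀ q' ∈ Q c, q - p ≠ q' - p') ∨
      (∀ p ∈ P (π σ), ∀ q ∈ Q (π τ), ∀ c : Fin r, ∀ p' ∈ P c, ∀ q' ∈ Q c, q - p ≠ q' - p')) :
    (∀ σ : Fin r, ∀ a ∈ P σ ×ˢ P (π σ), ∀ a' ∈ P σ ×ˢ P (π σ),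
      ∀ b ∈ Q σ ×ˢ Q (π σ), ∀ b' ∈ Q σ ×ˢ Q (π σ),
        (a - a') + (b - b') = 0 → a = a' ∧ b = b') ∧
    (∀ i j k : Fin r, ∀ a ∈ P i ×ˢ P (π i), ∀ a' ∈ P j ×ˢ P (π j),
      ∀ b ∈ Q j ×ˢ Q (π j), ∀ b' ∈ Q k ×ˢ Q (π k),
        (a - a') + (b - b') = 0 → i = k) := by
  refine ⟨?_, ?_⟩
  · -- (W): directness in each coordinate
    intro σ a ha a' ha' b hb b' hb' h
    rw [Finset.mem_product] at ha ha' hb hb'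
    obtain ⟨e1, f1⟩ := hD σ a.1 ha.1 a'.1 ha'.1 b.1 hb.1 b'.1 hb'.1 (rel_fst h)
    obtain ⟨e2, f2⟩ := hD (π σ) a.2 ha.2 a'.2 ha'.2 b.2 hb.2 b'.2 hb'.2 (rel_snd h)
    exact ⟨Prod.ext e1 e2, Prod.ext f1 f2⟩
  · -- (X): the certificate `hπ i k` selects the separating coordinate; `core` closes it
    intro i j k a ha a' ha' b hb b' hb' h
    rw [Finset.mem_product] at ha ha' hb hb'
    by_contra hik
    rcases hπ i k hik with hs | hs
    · exact core hs ha.1 ha'.1 hb.1 hb'.1 (rel_fst h)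
    · exact core hs ha.2 ha'.2 hb.2 hb'.2 (rel_snd h)

/-- **Worked certificate: Shannon's pentagon.**  In `ℤ/5` the five letters `P u = {u}`, `Q u = {u, u + 1}`
are direct, and with `π u = 2u` every ordered pair of distinct letters is strongly separated directly
(when `τ - σ ∈ {2, 3}`) or after `π` (when `τ - σ ∈ {1, 4}`); both facts are decided by the kernel (the
disjunct is chosen by the explicit certificate `τ - σ ∈ {2, 3}`, so that each `decide` sees one disjunct),
and `selfConverseLift` yields five blocks `({u} ×ˢ {2u}, {u, u+1} ×ˢ {2u, 2u+1})` in `ℤ/5 × ℤ/5`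
satisfying (W) and (X). -/
theorem pentagon_lift :
    let P : Fin 5 → Finset (ZMod 5) := fun u => {(u.val : ZMod 5)}
    let Q : Fin 5 → Finset (ZMod 5) := fun u => {(u.val : ZMod 5), (u.val : ZMod 5) + 1}
    let π : Fin 5 → Fin 5 := fun u => 2 * u
    (∀ σ : Fin 5, ∀ a ∈ P σ ×ˢ P (π σ), ∀ a' ∈ P σ ×ˢ P (π σ),
      ∀ b ∈ Q σ ×ˢ Q (π σ), ∀ b' ∈ Q σ ×ˢ Q (π σ),
        (a - a') + (b - b') = 0 → a = a' ∧ b = b') ∧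
    (∀ i j k : Fin 5, ∀ a ∈ P i ×ˢ P (π i), ∀ a' ∈ P j ×ˢ P (π j),
      ∀ b ∈ Q j ×ˢ Q (π j), ∀ b' ∈ Q k ×ˢ Q (π k),
        (a - a') + (b - b') = 0 → i = k) := by
  intro P Q π
  refine selfConverseLift P Q (by decide) π ?_
  intro σ τ hne
  by_cases hd : (τ.val : ZMod 5) - σ.val = 2 ∨ (τ.val : ZMod 5) - σ.val = 3
  · left
    clear hne
    revert σ τ
    decide
  · right
    revert σ τ
    decide

end Summit.MatrixMultiplication.MatrixMultiplication.Theorems.PrimeTwoFamilies.SelfConverseLiftK12
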